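import Literature.Dynamics.Hyperbolic.CLPHyperbolicSetCalculus
import Mathlib.Analysis.Calculus.ContDiff.Comp
import Mathlib.Analysis.Calculus.MeanValue

/-!
# Iterates of a map near a Chow–Lin–Palmer hyperbolic set: Lipschitz control, uniform continuity of `D(ψ^j)`, and the CLP structure of `ψ^ν`

Topic `Literature/Dynamics/Hyperbolic`.  For `IsCLPHyperbolicSet ψ T P Q N λ Δ`
(`Literature/Dynamics/Hyperbolic/ChowLinPalmerShadowing.lean`, Pilyugin1999 §1.3.4 conditions (1)–(5)) and
a bound `‖Dψ‖ ≤ K`, `K ≥ 1`, on the closed `Δ`-neighbourhood of `T` (condition (5)):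

* `norm_iterate_sub_iterate_le` — along `j` steps, points `x + v`, `x + w` within `Δ/K^j` of `x ∈ T` stay
  within `Δ` of the orbit of `x` and separate at most like `K^i ‖v - w‖` (mean value inequality on the balls
  `B(ψ^i x, Δ) ⊆ T'`; Pilyugin's Lemma 1.1.3);
* `norm_fderiv_iterate_near_le` (`‖D(ψ^i)(x+v)‖ ≤ K^i`) and `exists_modulus_fderiv_iterate` — UNIFORM
  continuity of `y ↦ D(ψ^j)(y)` on such balls, uniformly in `x ∈ T` (chain rule + condition (5));
* `IsCLPHyperbolicSet.iterate` — **the CLP structure passes to the iterate `ψ^ν`** (`ν ≥ 1`) with the same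
  splitting and `N`, rate `λ^ν`, and neighbourhood size `Δ/(4K^ν)`: the reduction "fix `ν` with `Nλ^ν ≤ λ`
  and pass to `Ψ = ψ^ν`" of Pilyugin1999 §1.3.4 (1.91), made honest for condition (5).

All folklore calculus; used by the Chow–Lin–Palmer shadowing discharge (`CLPShadowing*`).
References: S. Yu. Pilyugin, *Shadowing in Dynamical Systems*, LNM 1706 (1999), §1.1 Lemma 1.1.3, §1.3.4.
-/

noncomputable section

open Set Function Metric
open scoped Topology

namespace Literature.Dynamics.Hyperbolic

variable {E : Type*} [NormedAddCommGroup E] [NormedSpace ℝ E]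
variable {ψ : E → E} {T : Set E} {P Q : E → E →L[ℝ] E} {N lam Δ : ℝ}

/-! ## A derivative bound `K ≥ 1` on the `Δ`-neighbourhood -/

/-- Condition (5) provides `K ≥ 1` with `‖Dψ(y)‖ ≤ K` on the closed `Δ`-neighbourhood of `T`. [folklore] -/
theorem IsCLPHyperbolicSet.exists_fderiv_bound (h : IsCLPHyperbolicSet ψ T P Q N lam Δ) :
    ∃ K : ℝ, 1 ≤ K ∧ ∀ y ∈ cthickening Δ T, ‖fderiv ℝ ψ y‖ ≤ K := by
  obtain ⟨M, hM⟩ := h.bounded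
  exact ⟨max M 1, le_max_right _ _, fun y hy => ((hM y hy).2).trans (le_max_left _ _)⟩

/-- Iterates of a `C¹` map are `C¹`. [folklore] -/
theorem contDiff_one_iterate (hψ : ContDiff ℝ 1 ψ) (m : ℕ) : ContDiff ℝ 1 (ψ^[m]) := by
  induction m with
  | zero => simpa only [Function.iterate_zero] using contDiff_id
  | succ m ih => rw [Function.iterate_succ']; exact hψ.comp ih

omit [NormedSpace ℝ E] in
/-- A point of the closed `δ`-neighbourhood of `T` is within `2δ` of a point of `T` (`δ > 0`). [folklore] -/
theorem exists_mem_norm_sub_lt_of_mem_cthickening {δ : ℝ} (hδ : 0 < δ) {y : E} (hy : y ∈ cthickening δ T) :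
    ∃ x ∈ T, ‖y - x‖ < 2 * δ := by
  have hy' : y ∈ thickening (2 * δ) T := cthickening_subset_thickening' (by linarith) (by linarith) T hy
  obtain ⟨x, hx, hd⟩ := mem_thickening_iff.1 hy'
  exact ⟨x, hx, by rwa [← dist_eq_norm]⟩

section Near

variable {K : ℝ}

/-- ONE STEP (mean value inequality): for `x ∈ T` and `‖v‖, ‖w‖ ≤ Δ`,
`‖ψ(x + v) - ψ(x + w)‖ ≤ K ‖v - w‖`. [folklore] -/
theorem IsCLPHyperbolicSet.norm_apply_sub_apply_le (h : IsCLPHyperbolicSet ψ T P Q N lam Δ)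
    (hK : ∀ y ∈ cthickening Δ T, ‖fderiv ℝ ψ y‖ ≤ K) {x : E} (hx : x ∈ T) {v w : E} (hv : ‖v‖ ≤ Δ)
    (hw : ‖w‖ ≤ Δ) : ‖ψ (x + v) - ψ (x + w)‖ ≤ K * ‖v - w‖ := by
  have hball : ∀ z ∈ closedBall x Δ, ‖fderiv ℝ ψ z‖ ≤ K := fun z hz =>
    hK z (mem_cthickening_of_dist_le z x Δ T hx (mem_closedBall.1 hz))
  have hdiff : ∀ z ∈ closedBall x Δ, DifferentiableAt ℝ ψ z := fun z _ =>
    (h.contDiff.differentiable one_ne_zero) z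
  have hmv : x + v ∈ closedBall x Δ := by simpa [mem_closedBall_iff_norm] using hv
  have hmw : x + w ∈ closedBall x Δ := by simpa [mem_closedBall_iff_norm] using hw
  have := (convex_closedBall x Δ).norm_image_sub_le_of_norm_fderiv_le hdiff hball hmw hmv
  simpa [add_sub_add_left_eq_sub] using this

/-- `Δ / K^j ≤ Δ / K^i ≤ Δ` bookkeeping: `K^i (Δ/K^j) ≤ Δ` for `i ≤ j`, `K ≥ 1`. [folklore] -/
theorem pow_mul_div_pow_le (hK1 : 1 ≤ K) (hΔ : 0 ≤ Δ) {i j : ℕ} (hij : i ≤ j) :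
    K ^ i * (Δ / K ^ j) ≤ Δ := by
  have hKpos : 0 < K := one_pos.trans_le hK1
  have hKj : 0 < K ^ j := pow_pos hKpos j
  rw [mul_div_assoc', div_le_iff₀ hKj]
  calc K ^ i * Δ ≤ K ^ j * Δ := mul_le_mul_of_nonneg_right (pow_le_pow_right₀ hK1 hij) hΔ
    _ = Δ * K ^ j := mul_comm _ _

/-- **Lipschitz control of iterates near `T`** (Pilyugin's Lemma 1.1.3, uniform version): for `x ∈ T`,
`‖v‖, ‖w‖ ≤ Δ/K^j` and `i ≤ j`, `‖ψ^i(x + v) - ψ^i(x + w)‖ ≤ K^i ‖v - w‖`. [cite: Pilyugin1999, Lemma 1.1.3] -/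
theorem IsCLPHyperbolicSet.norm_iterate_sub_iterate_le (h : IsCLPHyperbolicSet ψ T P Q N lam Δ)
    (hK : ∀ y ∈ cthickening Δ T, ‖fderiv ℝ ψ y‖ ≤ K) (hK1 : 1 ≤ K) {x : E} (hx : x ∈ T) (j : ℕ) :
    ∀ i : ℕ, i ≤ j → ∀ v w : E, ‖v‖ ≤ Δ / K ^ j → ‖w‖ ≤ Δ / K ^ j →
      ‖ψ^[i] (x + v) - ψ^[i] (x + w)‖ ≤ K ^ i * ‖v - w‖ := by
  intro i
  induction i with
  | zero => intro _ v w _ _; simp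
  | succ i ih =>
    intro hi v w hv hw
    have hi' : i ≤ j := (Nat.le_succ i).trans hi
    have hKpos : 0 < K := one_pos.trans_le hK1
    -- displacements after `i` steps
    have h0 : ‖(0 : E)‖ ≤ Δ / K ^ j := by rw [norm_zero]; exact div_nonneg h.Δ_pos.le (pow_nonneg hKpos.le _)
    have hvi : ‖ψ^[i] (x + v) - ψ^[i] x‖ ≤ Δ := by
      have := ih hi' v 0 hv h0
      rw [add_zero, sub_zero] at this
      exact this.trans ((mul_le_mul_of_nonneg_left hv (pow_nonneg hKpos.le _)).trans
        (pow_mul_div_pow_le hK1 h.Δ_pos.le hi'))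
    have hwi : ‖ψ^[i] (x + w) - ψ^[i] x‖ ≤ Δ := by
      have := ih hi' w 0 hw h0
      rw [add_zero, sub_zero] at this
      exact this.trans ((mul_le_mul_of_nonneg_left hw (pow_nonneg hKpos.le _)).trans
        (pow_mul_div_pow_le hK1 h.Δ_pos.le hi'))
    have hxi : ψ^[i] x ∈ T := h.iterate_mem hx i
    have key := h.norm_apply_sub_apply_le hK hxi hvi hwi
    rw [add_sub_cancel, add_sub_cancel, sub_sub_sub_cancel_right] at key
    rw [Function.iterate_succ_apply', Function.iterate_succ_apply']
    calc ‖ψ (ψ^[i] (x + v)) - ψ (ψ^[i] (x + w))‖ ≤ K * ‖ψ^[i] (x + v) - ψ^[i] (x + w)‖ := key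
      _ ≤ K * (K ^ i * ‖v - w‖) := mul_le_mul_of_nonneg_left (ih hi' v w hv hw) hKpos.le
      _ = K ^ (i + 1) * ‖v - w‖ := by ring

/-- Centre version: `‖ψ^i(x + v) - ψ^i(x)‖ ≤ K^i ‖v‖ ≤ Δ` for `‖v‖ ≤ Δ/K^j`, `i ≤ j`. [folklore] -/
theorem IsCLPHyperbolicSet.norm_iterate_sub_le (h : IsCLPHyperbolicSet ψ T P Q N lam Δ)
    (hK : ∀ y ∈ cthickening Δ T, ‖fderiv ℝ ψ y‖ ≤ K) (hK1 : 1 ≤ K) {x : E} (hx : x ∈ T) {j i : ℕ}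
    (hij : i ≤ j) {v : E} (hv : ‖v‖ ≤ Δ / K ^ j) :
    ‖ψ^[i] (x + v) - ψ^[i] x‖ ≤ K ^ i * ‖v‖ ∧ K ^ i * ‖v‖ ≤ Δ := by
  have hKpos : 0 < K := one_pos.trans_le hK1
  have h0 : ‖(0 : E)‖ ≤ Δ / K ^ j := by rw [norm_zero]; exact div_nonneg h.Δ_pos.le (pow_nonneg hKpos.le _)
  have := h.norm_iterate_sub_iterate_le hK hK1 hx j i hij v 0 hv h0
  rw [add_zero, sub_zero] at this
  exact ⟨this, (mul_le_mul_of_nonneg_left hv (pow_nonneg hKpos.le _)).trans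
    (pow_mul_div_pow_le hK1 h.Δ_pos.le hij)⟩

/-- Such points stay in the closed `Δ`-neighbourhood: `ψ^i(x + v) ∈ T'`. [folklore] -/
theorem IsCLPHyperbolicSet.iterate_mem_cthickening (h : IsCLPHyperbolicSet ψ T P Q N lam Δ)
    (hK : ∀ y ∈ cthickening Δ T, ‖fderiv ℝ ψ y‖ ≤ K) (hK1 : 1 ≤ K) {x : E} (hx : x ∈ T) {j i : ℕ}
    (hij : i ≤ j) {v : E} (hv : ‖v‖ ≤ Δ / K ^ j) : ψ^[i] (x + v) ∈ cthickening Δ T := by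
  obtain ⟨h1, h2⟩ := h.norm_iterate_sub_le hK hK1 hx hij hv
  exact mem_cthickening_of_dist_le _ _ Δ T (h.iterate_mem hx i) (by rw [dist_eq_norm]; exact h1.trans h2)

/-- **Derivative bound for iterates near `T`**: `‖D(ψ^i)(x + v)‖ ≤ K^i` for `‖v‖ ≤ Δ/K^j`, `i ≤ j`. [folklore] -/
theorem IsCLPHyperbolicSet.norm_fderiv_iterate_near_le (h : IsCLPHyperbolicSet ψ T P Q N lam Δ)
    (hK : ∀ y ∈ cthickening Δ T, ‖fderiv ℝ ψ y‖ ≤ K) (hK1 : 1 ≤ K) {x : E} (hx : x ∈ T) {j : ℕ} {v : E}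
    (hv : ‖v‖ ≤ Δ / K ^ j) : ∀ i : ℕ, i ≤ j → ‖fderiv ℝ (ψ^[i]) (x + v)‖ ≤ K ^ i
  | 0 => fun _ => by
    simp only [Function.iterate_zero, fderiv_id, pow_zero]
    exact ContinuousLinearMap.norm_id_le
  | i + 1 => fun hi => by
    have hi' : i ≤ j := (Nat.le_succ i).trans hi
    rw [h.fderiv_iterate_succ i (x + v), pow_succ, mul_comm]
    exact (ContinuousLinearMap.opNorm_comp_le _ _).trans (mul_le_mul
      (hK _ (h.iterate_mem_cthickening hK hK1 hx hi' hv)) (h.norm_fderiv_iterate_near_le hK hK1 hx hv i hi')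
      (norm_nonneg _) ((one_pos.trans_le hK1).le))

/-- **Uniform continuity of `D(ψ^j)` near `T`, uniformly in the base point**: for every `j` and `ω > 0`
there is `ρ > 0` such that `‖D(ψ^i)(x + v) - D(ψ^i)(x + w)‖ ≤ ω` whenever `x ∈ T`, `‖v‖, ‖w‖ ≤ Δ/K^j`,
`‖v - w‖ ≤ ρ`, `i ≤ j` (chain rule + condition (5)). [folklore] -/
theorem IsCLPHyperbolicSet.exists_modulus_fderiv_iterate (h : IsCLPHyperbolicSet ψ T P Q N lam Δ)
    (hK : ∀ y ∈ cthickening Δ T, ‖fderiv ℝ ψ y‖ ≤ K) (hK1 : 1 ≤ K) (j : ℕ) :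
    ∀ i : ℕ, i ≤ j → ∀ ω : ℝ, 0 < ω → ∃ ρ : ℝ, 0 < ρ ∧ ∀ x ∈ T, ∀ v w : E,
      ‖v‖ ≤ Δ / K ^ j → ‖w‖ ≤ Δ / K ^ j → ‖v - w‖ ≤ ρ →
        ‖fderiv ℝ (ψ^[i]) (x + v) - fderiv ℝ (ψ^[i]) (x + w)‖ ≤ ω := by
  intro i
  induction i with
  | zero =>
    intro _ ω hω
    refine ⟨1, one_pos, fun x _ v w _ _ _ => ?_⟩
    simp only [Function.iterate_zero, fderiv_id, sub_self, norm_zero]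
    exact hω.le
  | succ i ih =>
    intro hi ω hω
    have hi' : i ≤ j := (Nat.le_succ i).trans hi
    have hKpos : 0 < K := one_pos.trans_le hK1
    have hKi : 0 < K ^ i := pow_pos hKpos i
    -- uniform continuity of `Dψ` on `T'` at scale `ω / (2 K^i)`
    obtain ⟨δ₁, hδ₁, hunif⟩ := Metric.uniformContinuousOn_iff.1 h.uniformContinuousOn_fderiv (ω / (2 * K ^ i))
      (by positivity)
    obtain ⟨ρ₂, hρ₂, hmod⟩ := ih hi' (ω / (2 * K)) (by positivity)
    refine ⟨min (δ₁ / (2 * K ^ i)) ρ₂, lt_min (by positivity) hρ₂, fun x hx v w hv hw hvw => ?_⟩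
    set p := ψ^[i] (x + v) with hp
    set p' := ψ^[i] (x + w) with hp'
    have hpc : p ∈ cthickening Δ T := h.iterate_mem_cthickening hK hK1 hx hi' hv
    have hpc' : p' ∈ cthickening Δ T := h.iterate_mem_cthickening hK hK1 hx hi' hw
    have hpp' : dist p p' < δ₁ := by
      rw [dist_eq_norm]
      calc ‖p - p'‖ ≤ K ^ i * ‖v - w‖ := h.norm_iterate_sub_iterate_le hK hK1 hx j i hi' v w hv hw
        _ ≤ K ^ i * (δ₁ / (2 * K ^ i)) := mul_le_mul_of_nonneg_left (hvw.trans (min_le_left _ _)) hKi.le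
        _ = δ₁ / 2 := by field_simp
        _ < δ₁ := half_lt_self hδ₁
    have h1 : ‖fderiv ℝ ψ p - fderiv ℝ ψ p'‖ ≤ ω / (2 * K ^ i) := by
      have := hunif p hpc p' hpc' hpp'
      rw [dist_eq_norm] at this
      exact this.le
    have h2 : ‖fderiv ℝ (ψ^[i]) (x + v) - fderiv ℝ (ψ^[i]) (x + w)‖ ≤ ω / (2 * K) :=
      hmod x hx v w hv hw (hvw.trans (min_le_right _ _))
    have h3 : ‖fderiv ℝ (ψ^[i]) (x + v)‖ ≤ K ^ i := h.norm_fderiv_iterate_near_le hK hK1 hx hv i hi'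
    have h4 : ‖fderiv ℝ ψ p'‖ ≤ K := hK p' hpc'
    rw [h.fderiv_iterate_succ i (x + v), h.fderiv_iterate_succ i (x + w)]
    have e : (fderiv ℝ ψ p).comp (fderiv ℝ (ψ^[i]) (x + v)) - (fderiv ℝ ψ p').comp (fderiv ℝ (ψ^[i]) (x + w)) =
        (fderiv ℝ ψ p - fderiv ℝ ψ p').comp (fderiv ℝ (ψ^[i]) (x + v)) +
          (fderiv ℝ ψ p').comp (fderiv ℝ (ψ^[i]) (x + v) - fderiv ℝ (ψ^[i]) (x + w)) := by
      rw [ContinuousLinearMap.sub_comp, ContinuousLinearMap.comp_sub]; abel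
    rw [← hp, ← hp', e]
    calc ‖(fderiv ℝ ψ p - fderiv ℝ ψ p').comp (fderiv ℝ (ψ^[i]) (x + v)) +
          (fderiv ℝ ψ p').comp (fderiv ℝ (ψ^[i]) (x + v) - fderiv ℝ (ψ^[i]) (x + w))‖
        ≤ ‖fderiv ℝ ψ p - fderiv ℝ ψ p'‖ * ‖fderiv ℝ (ψ^[i]) (x + v)‖ +
          ‖fderiv ℝ ψ p'‖ * ‖fderiv ℝ (ψ^[i]) (x + v) - fderiv ℝ (ψ^[i]) (x + w)‖ :=
          (norm_add_le _ _).trans (add_le_add (ContinuousLinearMap.opNorm_comp_le _ _)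
            (ContinuousLinearMap.opNorm_comp_le _ _))
      _ ≤ ω / (2 * K ^ i) * K ^ i + K * (ω / (2 * K)) := by
          gcongr
      _ = ω := by field_simp; ring

end Near

/-! ## The CLP structure of the iterate `ψ^ν` -/

/-- **A Chow–Lin–Palmer hyperbolic structure passes to iterates**: if `T` carries a CLP structure for `ψ`
with constants `(N, λ, Δ)` then, for `ν ≥ 1`, it carries one for `ψ^ν` with the same splitting and `N`,
rate `λ^ν` and some `Δ' > 0` (namely `Δ/(4K^ν)`, `‖Dψ‖ ≤ K` on `T'`).  This is the passage to `Ψ = ψ^ν`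
with `Nλ^ν` small of Pilyugin1999 §1.3.4 (1.91), including the verification of condition (5) for `Ψ`.
[cite: Pilyugin1999, §1.3.4 (1.91)] -/
theorem IsCLPHyperbolicSet.iterate (h : IsCLPHyperbolicSet ψ T P Q N lam Δ) {ν : ℕ} (hν : 1 ≤ ν) :
    ∃ Δ' : ℝ, 0 < Δ' ∧ IsCLPHyperbolicSet (ψ^[ν]) T P Q N (lam ^ ν) Δ' := by
  obtain ⟨K, hK1, hK⟩ := h.exists_fderiv_bound
  obtain ⟨M₀, hM₀⟩ := h.bounded
  have hKpos : 0 < K := one_pos.trans_le hK1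
  have hKν : 0 < K ^ ν := pow_pos hKpos ν
  set Δ' : ℝ := Δ / (4 * K ^ ν) with hΔ'
  have hΔ'pos : 0 < Δ' := div_pos h.Δ_pos (by positivity)
  have h3Δ' : 3 * Δ' ≤ Δ / K ^ ν := by
    have e : Δ' = Δ / K ^ ν / 4 := by rw [hΔ', div_div, mul_comm]
    have : 0 ≤ Δ / K ^ ν := div_nonneg h.Δ_pos.le hKν.le
    rw [e]; linarith
  -- points of the `Δ'`-neighbourhood, written around a point of `T`
  have hnear : ∀ y ∈ cthickening Δ' T, ∃ x ∈ T, ‖y - x‖ < 2 * Δ' := fun y hy =>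
    exists_mem_norm_sub_lt_of_mem_cthickening hΔ'pos hy
  refine ⟨Δ', hΔ'pos, ?_⟩
  exact
  { contDiff := contDiff_one_iterate h.contDiff ν
    mapsTo := h.mapsTo.iterate ν
    add_eq := h.add_eq
    isIdempotentElem := h.isIdempotentElem
    continuousOn_P := h.continuousOn_P
    continuousOn_Q := h.continuousOn_Q
    mapsTo_stable := fun x hx => h.mapsTo_stable_iterate hx ν
    bijOn_unstable := fun x hx => h.bijOn_unstable_iterate hx ν
    antilipschitz_unstable := fun x hx => by
      refine ⟨N * lam ^ ν, fun u hu => ?_⟩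
      have hmem : fderiv ℝ (ψ^[ν]) x u ∈ range (Q (ψ^[ν] x)) := (h.bijOn_unstable_iterate hx ν).mapsTo hu
      have heq : fderiv ℝ (ψ^[ν]) x u = Q (ψ^[ν] x) (fderiv ℝ (ψ^[ν]) x u) :=
        (h.Q_apply_of_mem_Q (h.iterate_mem hx ν) hmem).symm
      have := h.norm_le_of_fderiv_iterate_eq x hx ν hν _ u hu heq
      simpa only [mul_assoc] using this
    N_pos := h.N_pos
    lam_pos := pow_pos h.lam_pos ν
    lam_lt_one := pow_lt_one₀ h.lam_pos.le h.lam_lt_one (by omega)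
    norm_P_le := h.norm_P_le
    norm_Q_le := h.norm_Q_le
    norm_fderiv_iterate_comp_P_le := fun x hx m hm => by
      rw [← Function.iterate_mul, ← pow_mul]
      exact h.norm_fderiv_iterate_comp_P_le x hx (ν * m)
        (Nat.one_le_iff_ne_zero.2 (Nat.mul_ne_zero (by omega) (by omega)))
    norm_le_of_fderiv_iterate_eq := fun x hx m hm v u hu heq => by
      rw [← Function.iterate_mul] at heq
      rw [← pow_mul]
      exact h.norm_le_of_fderiv_iterate_eq x hx (ν * m)
        (Nat.one_le_iff_ne_zero.2 (Nat.mul_ne_zero (by omega) (by omega))) v u hu heq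
    Δ_pos := hΔ'pos
    bounded := by
      refine ⟨max M₀ (K ^ ν), fun y hy => ?_⟩
      obtain ⟨x, hx, hyx⟩ := hnear y hy
      have hv : ‖y - x‖ ≤ Δ / K ^ ν := by linarith
      have e : y = x + (y - x) := by abel
      constructor
      · obtain ⟨k, rfl⟩ : ∃ k, ν = k + 1 := ⟨ν - 1, by omega⟩
        rw [Function.iterate_succ_apply']
        have hmem : ψ^[k] y ∈ cthickening Δ T := by
          rw [e]; exact h.iterate_mem_cthickening hK hK1 hx (Nat.le_succ k) hv
        exact (hM₀ _ hmem).1.trans (le_max_left _ _)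
      · rw [e]
        exact (h.norm_fderiv_iterate_near_le hK hK1 hx hv ν le_rfl).trans (le_max_right _ _)
    uniformContinuousOn := by
      rw [Metric.uniformContinuousOn_iff]
      intro ε hε
      refine ⟨min Δ' (ε / K ^ ν), lt_min hΔ'pos (by positivity), fun y hy y' hy' hyy' => ?_⟩
      obtain ⟨x, hx, hyx⟩ := hnear y hy
      have hv : ‖y - x‖ ≤ Δ / K ^ ν := by linarith
      have hv' : ‖y' - x‖ ≤ Δ / K ^ ν := by
        have h1 : ‖y' - x‖ ≤ ‖y' - y‖ + ‖y - x‖ := norm_sub_le_norm_sub_add_norm_sub _ _ _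
        have h2 : ‖y' - y‖ < Δ' := by
          rw [← dist_eq_norm, dist_comm]; exact hyy'.trans_le (min_le_left _ _)
        linarith
      have key := h.norm_iterate_sub_iterate_le hK hK1 hx ν ν le_rfl (y - x) (y' - x) hv hv'
      rw [add_sub_cancel, add_sub_cancel, sub_sub_sub_cancel_right] at key
      rw [dist_eq_norm]
      calc ‖ψ^[ν] y - ψ^[ν] y'‖ ≤ K ^ ν * ‖y - y'‖ := key
        _ < K ^ ν * (ε / K ^ ν) := by
            apply mul_lt_mul_of_pos_left _ hKν
            rw [← dist_eq_norm]; exact hyy'.trans_le (min_le_right _ _)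
        _ = ε := by field_simp
    uniformContinuousOn_fderiv := by
      rw [Metric.uniformContinuousOn_iff]
      intro ε hε
      obtain ⟨ρ, hρ, hmod⟩ := h.exists_modulus_fderiv_iterate hK hK1 ν ν le_rfl (ε / 2) (half_pos hε)
      refine ⟨min Δ' ρ, lt_min hΔ'pos hρ, fun y hy y' hy' hyy' => ?_⟩
      obtain ⟨x, hx, hyx⟩ := hnear y hy
      have hv : ‖y - x‖ ≤ Δ / K ^ ν := by linarith
      have hv' : ‖y' - x‖ ≤ Δ / K ^ ν := by
        have h1 : ‖y' - x‖ ≤ ‖y' - y‖ + ‖y - x‖ := norm_sub_le_norm_sub_add_norm_sub _ _ _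
        have h2 : ‖y' - y‖ < Δ' := by
          rw [← dist_eq_norm, dist_comm]; exact hyy'.trans_le (min_le_left _ _)
        linarith
      have hvw : ‖(y - x) - (y' - x)‖ ≤ ρ := by
        rw [sub_sub_sub_cancel_right, ← dist_eq_norm]; exact (hyy'.trans_le (min_le_right _ _)).le
      have key := hmod x hx (y - x) (y' - x) hv hv' hvw
      rw [add_sub_cancel, add_sub_cancel] at key
      rw [dist_eq_norm]
      linarith }

end Literature.Dynamics.Hyperbolic

end
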